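import Literature.NumberTheory.Automorphic.ArchLocalTorusOrbitalCompactWallDeriv    -- ★ p840082 (J-cw) + ★ p839953∕p839989 (C-cw) (block properness, `sign_of_wallLabel`, `blockSeparated_of_ne`)
import Literature.NumberTheory.Automorphic.ArchTorusOrbitalFunctionAtPoint          -- ★ (F0P3a-p02) §1 generic: `orbitalIntegral_quotientMeasure_eq_integral_conj_of_isCompact`
import HarnessLib

/-!
# The centraliser of a block-separated torus point of `G_w = U(σ_w diag α)(ℂ)` is COMPACT; (J-cw) in the orbital-integral currency of the letter (J-nc)
# (ROAD-Sd rider «(J-cw)-desc»; Rogawski 1990 §8.2 pp. 122–123: at `γ₀′` the centraliser is the compact `U(2) × U(1)`)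

Topic `NumberTheory/Automorphic`; namespace `Literature.NumberTheory.Automorphic.UnitaryGroup`.  THEOREMS ONLY (no `def`, no instance, no notation, no axiom, no named
fact, no `sorry`).  Cell `pub/hodgecm-mathlib`, ENGINE T1 (crux H413 = `stmt-HodgeConjecture-24833`); floor-1 preparation, count-neutral, under books rows #111 (S-d) ∕ #88
(ST-∞): ROAD-Sd map of record `CENSUS-ROAD-Sd-letters` (3ec10e9b), rider **«(J-cw)-desc»** to clause (J-cw) (self-directed follow-up announced on the bus 02:32Z under LEAD
F0P3a-plan (g9)); author F0P3a-p06 (g10); per place (desk ruling T6-84 (V7)).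

KEY OBSERVATION: ★ (C-cw) `isCompact_setOf_exists_conj_circleDiagonal_mem_of_blocks` (p839953) with the ONE-POINT compacta `K = {z}`, `C = {t_w z}` says exactly that the
centraliser `Z(t_w z) = {g | g·t_w(z)·g⁻¹ = t_w(z)}` is compact, for every block-separated `z` with constant-sign blocks — at a regular point this is ★ p839507
`isCompact_centralizer_circleDiagonal` (`Z = T_w`), at a compact wall of `U(2,1)` it is the compactness of `U(2) × U(1)`, obtained WITHOUT the centraliser model ★ (V9).
With a compact centraliser the Weil-form orbital integral by the Haar PROBABILITY measure `t` of `Z(t_w z)` is the plain group integral — ★ generic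
`orbitalIntegral_quotientMeasure_eq_integral_conj_of_isCompact` (F0P3a-p02) — so the (J-cw) limit ★ `tendsto_deriv_sin_smul_integral_compactWall` (p840082) reads in the
currency of the LETTER (J-nc) (`c · O_{t_w(z₀)}(Θ)`): at a COMPACT wall `c = 2` for the probability normalisation, and the limit is two-sided.

WHAT IS PROVED.
* §1 `setOf_exists_conj_mem_singleton_eq_centralizer`; **`isCompact_centralizer_circleDiagonal_of_blocks`** (labelling `b`, `hsign`, `z` block-separated);
  `isCompact_centralizer_circleDiagonal_compactWall` (`N = 3`, `0 < e_0 e_2`, `z 0 ≠ z 1`, `z 1 ≠ z 2` — `z 0 = z 2` allowed).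
* §2 **`orbitalIntegral_circleDiagonal_eq_integral_conj_of_blocks`** ∕ `…_compactWall` — `O_{t_w(z)}(a; ν ∕ t) = ∫_{G_w} a(g·t_w(z)·g⁻¹) dν(g)` (`t` the Haar probability
  measure on the compact centraliser, `a` continuous; by NAME over the ★ generic lemma);
  **`tendsto_deriv_sin_smul_integral_compactWall_orbitalIntegral`** — `Tendsto (fun ψ => deriv g_Θ ψ) (𝓝 0) (𝓝 ((2 : ℝ) • O_{t_w(z₀)}(Θ ∘ ↑↑·; ν ∕ t)))` at a compact wall
  (★ p840082 restated): the exact comparand of the (J-nc)∕(J-sgn) letters.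
NOT HERE: noncompact walls (LETTER (J-nc)); Haar measures on the centraliser of other total mass (rescale by ★ `ArchCentralValueTransfer`-style `nnreal_smul` bookkeeping when a
consumer fixes «compatible measures»).  HONEST LABEL: HC_CM is proved only modulo the printed citations until rung 0 closes; this file pays nothing by itself.

## References
* [Rogawski1990] J. D. Rogawski, *Automorphic Representations of Unitary Groups in Three Variables*, Ann. of Math. Stud. 123 (1990), §8.2 pp. 122–123 («`γ₀′` whose centralizer
  `H′` is the compact inner form of `H`»), §4.9 p. 54 (`Φ(γ, f) = ∫_{G_γ∖G}`), §1.7 p. 6 (measure conventions).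
* [Folland1995] G. B. Folland, *A Course in Abstract Harmonic Analysis* (1995), §2.6 Thm. 2.49 and (2.52) (quotient by a compact subgroup).
* [DeitmarEchterhoff2014] A. Deitmar, S. Echterhoff, *Principles of Harmonic Analysis*, 2nd ed. (2014), Lemma 9.3.3, Thm. 1.5.3.
-/

set_option autoImplicit false

noncomputable section

open MeasureTheory Measure NumberField NumberField.InfinitePlace Filter Topology Set
open Literature.MeasureTheory.Group
open scoped Matrix MatrixGroups Real
open scoped Matrix.Norms.Operator

namespace Literature.NumberTheory.Automorphic.UnitaryGroup

/-! ## §1 Compactness of the centraliser at a block-separated torus point -/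

/-- In any group: `{g | ∃ γ′ ∈ {γ}, g γ′ g⁻¹ ∈ {γ}}` is the centraliser of `γ`. [cite: DeitmarEchterhoff2014, Lemma 9.3.3] -/
theorem setOf_exists_conj_mem_singleton_eq_centralizer {G : Type*} [Group G] {T : Type*} (t : T → G) (z : T) :
    {g : G | ∃ z' ∈ ({z} : Set T), g * t z' * g⁻¹ ∈ ({t z} : Set G)} = ((Subgroup.centralizer ({t z} : Set G) : Subgroup G) : Set G) := by
  ext g
  simp only [Set.mem_setOf_eq, Set.mem_singleton_iff, exists_eq_left, SetLike.mem_coe, Subgroup.mem_centralizer_iff, forall_eq]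
  rw [mul_inv_eq_iff_eq_mul]
  exact ⟨fun h => h.symm, fun h => h.symm⟩

section Blocks

variable (L : Type) [Field L] (N : ℕ) (α : Fin N → L) (w : {w : InfinitePlace L // IsComplex w})

/-- **THE CENTRALISER OF A BLOCK-SEPARATED TORUS POINT IS COMPACT** (constant-sign blocks): ★ (C-cw) joint properness with the one-point compacta `K = {z}`, `C = {t_w z}`.
For `z` regular this is ★ `isCompact_centralizer_circleDiagonal` (`Z = T_w`); at a compact wall of `U(2,1)` it is the compactness of `U(2) × U(1)`.
[cite: Rogawski1990, §8.2 pp. 122–123] [cite: DeitmarEchterhoff2014, Lemma 9.3.3] -/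
theorem isCompact_centralizer_circleDiagonal_of_blocks (hα : ∀ i, α i ≠ 0) (hreal : ∀ i, (w.1.embedding (α i)).im = 0)
    {ι : Type*} (b : Fin N → ι) (hsign : ∀ i j, i ≠ j → b i = b j → 0 < (w.1.embedding (α i)).re * (w.1.embedding (α j)).re)
    {z : Fin N → Circle} (hz : ∀ i j, b i ≠ b j → z i ≠ z j) :
    IsCompact ((Subgroup.centralizer ({(⟨circleDiagonal N z, circleDiagonal_mem_archLocal_diagonal L N α w z⟩ : archLocal L N (Matrix.diagonal α) w)} :
      Set (archLocal L N (Matrix.diagonal α) w)) : Subgroup (archLocal L N (Matrix.diagonal α) w)) : Set (archLocal L N (Matrix.diagonal α) w)) := by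
  rw [← setOf_exists_conj_mem_singleton_eq_centralizer
    (fun z' : Fin N → Circle => (⟨circleDiagonal N z', circleDiagonal_mem_archLocal_diagonal L N α w z'⟩ : archLocal L N (Matrix.diagonal α) w)) z]
  exact isCompact_setOf_exists_conj_circleDiagonal_mem_of_blocks L N α w hα hreal b hsign isCompact_singleton
    (Set.singleton_subset_iff.mpr hz) isCompact_singleton

end Blocks

section CompactWall

variable (L : Type) [Field L] (α : Fin 3 → L) (w : {w : InfinitePlace L // IsComplex w})

/-- **AT A COMPACT WALL OF A `U(2,1)`-TYPE PLACE THE CENTRALISER IS COMPACT**: `0 < e_0 e_2`, `z 0 ≠ z 1`, `z 1 ≠ z 2` (`z 0 = z 2` allowed: then `Z(t_w z) ≅ U(2) × U(1)`, print's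
`H′`). [cite: Rogawski1990, §8.2 pp. 122–123] [cite: DeitmarEchterhoff2014, Lemma 9.3.3] -/
theorem isCompact_centralizer_circleDiagonal_compactWall (hα : ∀ i, α i ≠ 0) (hreal : ∀ i, (w.1.embedding (α i)).im = 0)
    (h02e : 0 < (w.1.embedding (α 0)).re * (w.1.embedding (α 2)).re) {z : Fin 3 → Circle} (h01 : z 0 ≠ z 1) (h12 : z 1 ≠ z 2) :
    IsCompact ((Subgroup.centralizer ({(⟨circleDiagonal 3 z, circleDiagonal_mem_archLocal_diagonal L 3 α w z⟩ : archLocal L 3 (Matrix.diagonal α) w)} :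
      Set (archLocal L 3 (Matrix.diagonal α) w)) : Subgroup (archLocal L 3 (Matrix.diagonal α) w)) : Set (archLocal L 3 (Matrix.diagonal α) w)) :=
  isCompact_centralizer_circleDiagonal_of_blocks L 3 α w hα hreal (![(0 : ℕ), 1, 0]) (sign_of_wallLabel L α w h02e) (blockSeparated_of_ne h01 h12)

/-! ## §2 The orbital integral at a compact-centraliser torus point is the plain group integral; (J-cw) in that currency -/

variable [LocallyCompactSpace (archLocal L 3 (Matrix.diagonal α) w)] [SecondCountableTopology (archLocal L 3 (Matrix.diagonal α) w)]
  [MeasurableSpace (archLocal L 3 (Matrix.diagonal α) w)] [BorelSpace (archLocal L 3 (Matrix.diagonal α) w)]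
  [∀ g : archLocal L 3 (Matrix.diagonal α) w, MeasurableSpace (archLocal L 3 (Matrix.diagonal α) w ⧸ Subgroup.centralizer ({g} : Set (archLocal L 3 (Matrix.diagonal α) w)))]
  [∀ g : archLocal L 3 (Matrix.diagonal α) w, BorelSpace (archLocal L 3 (Matrix.diagonal α) w ⧸ Subgroup.centralizer ({g} : Set (archLocal L 3 (Matrix.diagonal α) w)))]
  {E : Type*} [NormedAddCommGroup E] [NormedSpace ℝ E]

/-- **`O_{t_w(z)}(a; dν ∕ dt) = ∫_{G_w} a(g · t_w(z) · g⁻¹) dν(g)` AT A COMPACT-WALL POINT** for the Haar PROBABILITY measure `t` on the (compact) centraliser and continuous `a` — ★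
generic `orbitalIntegral_quotientMeasure_eq_integral_conj_of_isCompact` docked with §1. [cite: Rogawski1990, §4.9 p. 54; §8.2 p. 123] [cite: Folland1995, §2.6 (2.52)] -/
theorem orbitalIntegral_circleDiagonal_compactWall_eq_integral_conj (hα : ∀ i, α i ≠ 0) (hreal : ∀ i, (w.1.embedding (α i)).im = 0)
    (h02e : 0 < (w.1.embedding (α 0)).re * (w.1.embedding (α 2)).re) {z : Fin 3 → Circle} (h01 : z 0 ≠ z 1) (h12 : z 1 ≠ z 2)
    (t : Measure (Subgroup.centralizer ({(⟨circleDiagonal 3 z, circleDiagonal_mem_archLocal_diagonal L 3 α w z⟩ : archLocal L 3 (Matrix.diagonal α) w)} :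
      Set (archLocal L 3 (Matrix.diagonal α) w)))) [t.IsHaarMeasure] [t.IsInvInvariant] [IsProbabilityMeasure t]
    (ν : Measure (archLocal L 3 (Matrix.diagonal α) w)) [ν.IsHaarMeasure] [ν.IsMulRightInvariant]
    (a : archLocal L 3 (Matrix.diagonal α) w → E) (ha : Continuous a) :
    orbitalIntegral (⟨circleDiagonal 3 z, circleDiagonal_mem_archLocal_diagonal L 3 α w z⟩ : archLocal L 3 (Matrix.diagonal α) w) a
        (quotientMeasure _ t (isClosed_coe_centralizer_singleton _) ν) =
      ∫ g, a (g * ⟨circleDiagonal 3 z, circleDiagonal_mem_archLocal_diagonal L 3 α w z⟩ * g⁻¹) ∂ν :=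
  orbitalIntegral_quotientMeasure_eq_integral_conj_of_isCompact _ (isCompact_centralizer_circleDiagonal_compactWall L α w hα hreal h02e h01 h12) t ν a ha

/-- **(J-cw) IN THE CURRENCY OF THE LETTER (J-nc)**: at a compact wall (`z₀ 0 = z₀ 2` allowed, `z₀ 0 ≠ z₀ 1`, `z₀ 1 ≠ z₀ 2`, `0 < e_0 e_2`), along the split curve,
`∂_ψ(2 sin ψ · F_Θ(z_ψ)) → 2 · O_{t_w(z₀)}(Θ; dν ∕ dt)` as `ψ → 0` (TWO-sided), `t` the Haar probability measure on the compact centraliser `U(2) × U(1)` — ★ (J-cw)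
`tendsto_deriv_sin_smul_integral_compactWall` (p840082) with its limit rewritten by the previous theorem.  The LETTER (J-nc) asserts the same SHAPE at a NONCOMPACT wall with
`𝓝[≠] 0` and Harish-Chandra's constant `c`; (J-sgn) compares `c` with this `2`. [cite: Rogawski1990, §8.2 p. 123] [cite: Folland1995, §2.6 (2.52)] -/
theorem tendsto_deriv_sin_smul_integral_compactWall_orbitalIntegral (hα : ∀ i, α i ≠ 0) (hreal : ∀ i, (w.1.embedding (α i)).im = 0)
    (h02e : 0 < (w.1.embedding (α 0)).re * (w.1.embedding (α 2)).re)
    (ν : Measure (archLocal L 3 (Matrix.diagonal α) w)) [ν.IsHaarMeasure] [ν.IsMulRightInvariant]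
    (Θ : Matrix (Fin 3) (Fin 3) ℂ → E) (hΘ : ContDiff ℝ 1 Θ)
    (hfc : HasCompactSupport fun k : archLocal L 3 (Matrix.diagonal α) w => Θ (((k : GL (Fin 3) ℂ) : Matrix (Fin 3) (Fin 3) ℂ)))
    {z₀ : Fin 3 → Circle} (h01 : z₀ 0 ≠ z₀ 1) (h12 : z₀ 1 ≠ z₀ 2)
    (t : Measure (Subgroup.centralizer ({(⟨circleDiagonal 3 z₀, circleDiagonal_mem_archLocal_diagonal L 3 α w z₀⟩ : archLocal L 3 (Matrix.diagonal α) w)} :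
      Set (archLocal L 3 (Matrix.diagonal α) w)))) [t.IsHaarMeasure] [t.IsInvInvariant] [IsProbabilityMeasure t] :
    Tendsto (fun ψ : ℝ => deriv (fun ψ : ℝ => (2 * Real.sin ψ) • ∫ g : archLocal L 3 (Matrix.diagonal α) w,
        Θ ((((g * ⟨circleDiagonal 3 fun i => z₀ i * Circle.exp (![(1 : ℝ), 0, -1] i * ψ), circleDiagonal_mem_archLocal_diagonal L 3 α w _⟩ * g⁻¹ :
          archLocal L 3 (Matrix.diagonal α) w) : GL (Fin 3) ℂ) : Matrix (Fin 3) (Fin 3) ℂ)) ∂ν) ψ)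
      (𝓝 0) (𝓝 ((2 : ℝ) • orbitalIntegral (⟨circleDiagonal 3 z₀, circleDiagonal_mem_archLocal_diagonal L 3 α w z₀⟩ : archLocal L 3 (Matrix.diagonal α) w)
        (fun k : archLocal L 3 (Matrix.diagonal α) w => Θ (((k : GL (Fin 3) ℂ) : Matrix (Fin 3) (Fin 3) ℂ)))
        (quotientMeasure _ t (isClosed_coe_centralizer_singleton _) ν))) := by
  rw [orbitalIntegral_circleDiagonal_compactWall_eq_integral_conj L α w hα hreal h02e h01 h12 t ν
    (fun k : archLocal L 3 (Matrix.diagonal α) w => Θ (((k : GL (Fin 3) ℂ) : Matrix (Fin 3) (Fin 3) ℂ)))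
    (hΘ.continuous.comp (Units.continuous_val.comp continuous_subtype_val))]
  exact tendsto_deriv_sin_smul_integral_compactWall L α w ν hα hreal h02e Θ hΘ hfc h01 h12

end CompactWall

end Literature.NumberTheory.Automorphic.UnitaryGroup

end
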